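import Literature.NumberTheory.LFunctions.RayClasses
import Literature.NumberTheory.LFunctions.RayClassConductor
import Literature.NumberTheory.GaloisRepresentations.GrossencharakterIdeleValue
import Mathlib.NumberTheory.NumberField.InfinitePlace.TotallyRealComplex
import HarnessLib

/-!
# The narrow ray class of `𝔠` mod `𝔪` is parametrised by the colon ideal `𝔠⁻¹𝔪`;
# values of a Größencharakter along it (the substitution `𝔞 = (α)𝔠` of de Shalit II.3.5 / Damerell)

Topic `Literature/NumberTheory/LFunctions`; namespace `Literature.NumberTheory.LFunctions`, continuing
`RayClasses.lean` (`RayClassRel 𝔪 𝔟 𝔞`: "`(c) 𝔞 = (b) 𝔟`, `b ≡ c mod 𝔪`, `c` prime to `𝔪`, `b/c` totally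
positive" — Neukirch VI (1.7)) and `RayClassCharacter.lean` (`idealPow K ψ 𝔞 = ∏ ψ(𝔭)^{ν_𝔭(𝔞)}`).
Theorems only; no definition, no named fact. This is the ideal-theoretic half of the identity
"Eisenstein numbers at CM points = partial Hecke `L`-values over ray classes" (de Shalit 1987 II.3.5 (13),
`Literature/NumberTheory/EllipticCurves/EisensteinNumbersPartialHeckeL.lean`), whose proof de Shalit
calls "a straightforward computation, which … boils down to (6)" (p. 54): the partial `L`-series over the
class of `𝔠` is re-indexed by `𝔞 = (α)𝔠`, `α ≡ 1 mod* 𝔪`, `α ∈ 1 + 𝔠⁻¹𝔪`, and `φ(𝔞) = φ(𝔠)·α` for a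
Größencharakter `φ` of type `(1, 0)` and conductor dividing `𝔪`.

* `div_sub_one_mem_div_of_span_mul_eq` — `(c)𝔞 = (b)𝔠`, `b ≡ c mod 𝔪`, `c` prime to `𝔪` ⇒
  `b/c − 1 ∈ 𝔪/𝔠` (Mathlib's colon of fractional ideals, `= 𝔠⁻¹𝔪` in a Dedekind domain);
* `exists_rayClassRel_of_mem_div` — conversely `x ∈ 𝔪/𝔠` gives `𝔞 = (1 + x)𝔠` in the class of `𝔠`, with
  explicit data `(b, c)`, `c ∈ 𝔠`, `c ≡ 1 mod 𝔪`, `b = c(1 + x)` (for `K` with no real place, `𝔪 ≠ (1)`);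
* `eq_of_span_mul_eq_of_units` — uniqueness of `b` given `c` when `w_𝔪 = 1` (no unit `≠ 1` is `≡ 1 mod 𝔪`);
* ★ `exists_equiv_div_rayClassRel` — **`𝔪/𝔠 ≃ {𝔞 : RayClassRel 𝔪 𝔠 𝔞}`, `x ↦ (1 + x)𝔠`**;
* `idealPow_ne_zero_of_isCoprime`, ★ `idealPow_eq_mul_of_span_mul_eq` — for `ψ̃ = idealPow K ψ` "of type `ιK`
  on the ray" (`ψ̃((b))·ιK(c) = ψ̃((c))·ιK(b)` for nonzero `b ≡ c mod 𝔪`, `c` prime to `𝔪`; de Shalit's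
  `φ((α)) = α`), `(c)𝔞 = (b)𝔠 ⇒ ψ̃(𝔞)·ιK(c) = ψ̃(𝔠)·ιK(b)`; `idealPow_span_mul_eq_of_isGrossencharakter` derives
  the hypothesis from the tree's `IsGrossencharakter 𝔪 p q ψ` when its archimedean factor is `ιK`.

References: J. Neukirch, *Algebraic Number Theory* (1999), Ch. VI §1 Def. (1.7), Ch. VII §6 (6.8),
Prop. (6.13), Cor. (6.14) [NeukirchANT1999]; E. de Shalit (1987), II.3.5 (p. 54) [deShalit1987].

Mathlib / tree search: Mathlib `FractionalIdeal.mem_div_iff_of_ne_zero`, `FractionalIdeal.mem_coeIdeal`,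
`Ideal.dvd_iff_le`, `Ideal.span_singleton_eq_span_singleton`, `Ideal.mem_span_singleton_mul`,
`IsTotallyComplex.complexEmbedding_not_isReal`, `Equiv.ofBijective`; tree `RayClassRel` (+ `.ne_bot_iff`,
`.isCoprime_iff`), `idealPow_mul`, `isCoprime_span_of_sub_mem`, `isCoprime_span_singleton_of_sub_one_mem`,
`mem_of_mul_mem_of_isCoprime` (`RayClassGaussSum` / `RayClassConductor`), `IsGrossencharakter.idealPow_span_eq`
(`lean search 'RayClassRel'`: no parametrisation of a class by a fractional ideal in the tree).
-/

noncomputable section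

open scoped nonZeroDivisors ComplexConjugate
open NumberField IsDedekindDomain
open Literature.NumberTheory.GaloisRepresentations

namespace Literature.NumberTheory.LFunctions

variable {K : Type*} [Field K] [NumberField K]

/-! ### §1. Ideal arithmetic: the ray class of `𝔠` mod `𝔪` versus the colon ideal `𝔪/𝔠 = 𝔠⁻¹𝔪` -/

section RayClass

variable {𝔪 𝔠 : Ideal (𝓞 K)}

omit [NumberField K] in
/-- A number field with no real place has no ring homomorphism to `ℝ` (so Neukirch's total-positivity
condition in `RayClassRel` is void). [folklore] -/
private theorem false_of_ringHom_real [IsTotallyComplex K] (τ : K →+* ℝ) : False := by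
  refine IsTotallyComplex.complexEmbedding_not_isReal (Complex.ofRealHom.comp τ) ?_
  rw [ComplexEmbedding.isReal_iff]
  ext x
  simp [ComplexEmbedding.conjugate_coe_eq]

/-- **`𝔞 ~ 𝔠` gives `α = b/c` with `𝔞 = (α)𝔠` and `α − 1 ∈ 𝔠⁻¹𝔪`.** If `(c)𝔞 = (b)𝔠` with `b ≡ c mod 𝔪`
and `c` prime to `𝔪`, then `b/c − 1` lies in the colon fractional ideal `𝔪/𝔠` (`= 𝔠⁻¹𝔪`): for `c' ∈ 𝔠`,
`b c' = c y` with `y ∈ 𝔞`, and `(b/c − 1)c' = y − c' ∈ 𝔪` because `c(y − c') = (b − c)c' ∈ 𝔪`.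
[cite: deShalit1987, II.3.5 (proof of (13))] -/
theorem div_sub_one_mem_div_of_span_mul_eq (h𝔠 : 𝔠 ≠ ⊥) {𝔞 : Ideal (𝓞 K)} {b c : 𝓞 K} (hc : c ≠ 0)
    (hcop : IsCoprime (Ideal.span {c}) 𝔪) (hbc : b - c ∈ 𝔪)
    (heq : Ideal.span {c} * 𝔞 = Ideal.span {b} * 𝔠) :
    (b : K) / c - 1 ∈ ((𝔪 : FractionalIdeal (𝓞 K)⁰ K) / (𝔠 : FractionalIdeal (𝓞 K)⁰ K)) := by
  have hc' : (c : K) ≠ 0 := fun h ↦ hc (by exact_mod_cast h)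
  rw [FractionalIdeal.mem_div_iff_of_ne_zero (FractionalIdeal.coeIdeal_ne_zero.mpr h𝔠)]
  intro y hy
  obtain ⟨c', hc'𝔠, rfl⟩ := (FractionalIdeal.mem_coeIdeal (𝓞 K)⁰).mp hy
  -- `b c' ∈ (b)𝔠 = (c)𝔞`, so `b c' = c y'` with `y' ∈ 𝔞`
  have hbc' : b * c' ∈ Ideal.span {c} * 𝔞 := by
    rw [heq]; exact Ideal.mul_mem_mul (Ideal.mem_span_singleton_self b) hc'𝔠
  obtain ⟨y', -, hy'⟩ := Ideal.mem_span_singleton_mul.mp hbc'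
  refine (FractionalIdeal.mem_coeIdeal (𝓞 K)⁰).mpr ⟨y' - c', ?_, ?_⟩
  · refine mem_of_mul_mem_of_isCoprime hcop ?_
    have : (y' - c') * c = (b - c) * c' := by linear_combination hy'
    rw [this]; exact 𝔪.mul_mem_right _ hbc
  · have hy'K : (c : K) * y' = b * c' := by exact_mod_cast hy'
    rw [map_sub]
    change (y' : K) - c' = ((b : K) / c - 1) * c'
    field_simp
    linear_combination hy'K

/-- **Conversely, `x ∈ 𝔠⁻¹𝔪` gives an ideal `𝔞 = (1 + x)𝔠` in the narrow ray class of `𝔠` mod `𝔪`**, with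
explicit data: for `K` with no real place, `𝔪 ≠ (1)`, `𝔠` prime to `𝔪`, there are `𝔞` and nonzero
integers `b, c` with `c ∈ 𝔠`, `c ≡ 1 mod 𝔪` (so `c` prime to `𝔪`), `b ≡ c mod 𝔪`, `(c)𝔞 = (b)𝔠` and
`b = c(1 + x)`. [cite: deShalit1987, II.3.5 (proof of (13))] -/
theorem exists_rayClassRel_of_mem_div [IsTotallyComplex K] (h𝔪 : 𝔪 ≠ ⊤) (hcop : IsCoprime 𝔠 𝔪)
    {x : K} (hx : x ∈ ((𝔪 : FractionalIdeal (𝓞 K)⁰ K) / (𝔠 : FractionalIdeal (𝓞 K)⁰ K))) :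
    ∃ (𝔞 : Ideal (𝓞 K)) (b c : 𝓞 K), b ≠ 0 ∧ c ≠ 0 ∧ c ∈ 𝔠 ∧ c - 1 ∈ 𝔪 ∧ b - c ∈ 𝔪 ∧
      Ideal.span {c} * 𝔞 = Ideal.span {b} * 𝔠 ∧ (b : K) = c * (1 + x) ∧ RayClassRel 𝔪 𝔠 𝔞 := by
  have h𝔠 : 𝔠 ≠ ⊥ := by
    rintro rfl
    exact h𝔪 (by simpa using Ideal.isCoprime_iff_sup_eq.mp hcop)
  -- `c ∈ 𝔠` with `c ≡ 1 mod 𝔪`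
  obtain ⟨c, hc𝔠, m, hm, hcm⟩ := Ideal.isCoprime_iff_exists.mp hcop
  have hc1 : c - 1 ∈ 𝔪 := by
    have : c - 1 = -m := by linear_combination hcm
    rw [this]; exact 𝔪.neg_mem hm
  have hc0 : c ≠ 0 := by
    rintro rfl
    apply h𝔪
    rw [Ideal.eq_top_iff_one]
    simpa using 𝔪.neg_mem hc1
  have hccop : IsCoprime (Ideal.span {c}) 𝔪 := isCoprime_span_singleton_of_sub_one_mem hc1
  -- the integer `m₀ = c·x ∈ 𝔪`, and more generally `c'·x ∈ 𝔪` for `c' ∈ 𝔠`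
  rw [FractionalIdeal.mem_div_iff_of_ne_zero (FractionalIdeal.coeIdeal_ne_zero.mpr h𝔠)] at hx
  have hx' : ∀ c' ∈ 𝔠, ∃ m' ∈ 𝔪, algebraMap (𝓞 K) K m' = x * algebraMap (𝓞 K) K c' :=
    fun c' hc' ↦ (FractionalIdeal.mem_coeIdeal (𝓞 K)⁰).mp
      (hx _ ((FractionalIdeal.mem_coeIdeal (𝓞 K)⁰).mpr ⟨c', hc', rfl⟩))
  obtain ⟨m₀, hm₀, hm₀x⟩ := hx' c hc𝔠
  set b : 𝓞 K := c + m₀ with hb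
  have hbK : algebraMap (𝓞 K) K b = algebraMap (𝓞 K) K c * (1 + x) := by
    rw [hb, map_add, hm₀x]; ring
  have hcK : algebraMap (𝓞 K) K c ≠ 0 := fun h ↦
    hc0 (RingOfIntegers.coe_injective (by rw [h, map_zero]))
  have hb0 : b ≠ 0 := by
    intro h0
    have h1x : (1 : K) + x = 0 := by
      have : algebraMap (𝓞 K) K c * (1 + x) = 0 := by rw [← hbK, h0, map_zero]
      exact (mul_eq_zero.mp this).resolve_left hcK
    -- then `x = −1`, so `c·x = −c ∈ 𝔪`, `c ∈ 𝔪`, `1 ∈ 𝔪`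
    have hm₀c : m₀ = -c := RingOfIntegers.coe_injective (by
      rw [map_neg, hm₀x, show x = -1 by linear_combination h1x]; ring)
    apply h𝔪
    rw [Ideal.eq_top_iff_one]
    have hc𝔪 : c ∈ 𝔪 := by simpa [hm₀c] using 𝔪.neg_mem hm₀
    simpa using 𝔪.sub_mem hc𝔪 hc1
  -- `(b)𝔠 ≤ (c)`, hence `(c) ∣ (b)𝔠`: `𝔞` is the cofactor
  have hle : Ideal.span {b} * 𝔠 ≤ Ideal.span {c} := by
    rw [Ideal.span_singleton_mul_le_iff]
    intro c' hc'
    obtain ⟨m', -, hm'⟩ := hx' c' hc'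
    refine Ideal.mem_span_singleton'.mpr ⟨c' + m', RingOfIntegers.coe_injective ?_⟩
    rw [map_mul, map_mul, map_add, hb, map_add, hm', hm₀x]; ring
  obtain ⟨𝔞, h𝔞⟩ := Ideal.dvd_iff_le.mpr hle
  refine ⟨𝔞, b, c, hb0, hc0, hc𝔠, hc1, by simp [hb, hm₀], h𝔞.symm, hbK, ?_⟩
  exact ⟨b, c, hb0, hc0, hccop, by simp [hb, hm₀], fun τ ↦ (false_of_ringHom_real τ).elim, h𝔞.symm⟩

/-- **Uniqueness (`w_𝔪 = 1`)**: if `(c)𝔞 = (b)𝔠 = (b')𝔠`-type data with the SAME `c ≡ 1 mod 𝔪` present the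
same ideal, `(c)𝔞 = (b)𝔠` and `(c)𝔞 = (b')𝔠` with `b ≡ b' ≡ c mod 𝔪`, then `b = b'`: `(b) = (b')`, so
`b' = u b` for a unit `u ≡ 1 mod 𝔪` (as `b` is prime to `𝔪`), and `u = 1`. [cite: deShalit1987, II.3.5 (proof of (13))] -/
theorem eq_of_span_mul_eq_of_units (hw : ∀ u : (𝓞 K)ˣ, (u : 𝓞 K) - 1 ∈ 𝔪 → u = 1) (h𝔠 : 𝔠 ≠ ⊥)
    {𝔞 : Ideal (𝓞 K)} {b b' c : 𝓞 K} (hcop : IsCoprime (Ideal.span {c}) 𝔪) (hbc : b - c ∈ 𝔪)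
    (hb'c : b' - c ∈ 𝔪) (heq : Ideal.span {c} * 𝔞 = Ideal.span {b} * 𝔠)
    (heq' : Ideal.span {c} * 𝔞 = Ideal.span {b'} * 𝔠) : b = b' := by
  have hspan : Ideal.span {b} = Ideal.span {b'} :=
    mul_right_cancel₀ h𝔠 (heq.symm.trans heq')
  obtain ⟨u, hu⟩ := Ideal.span_singleton_eq_span_singleton.mp hspan
  -- `b (u − 1) = b' − b ∈ 𝔪` and `b` is prime to `𝔪`, so `u ≡ 1 mod 𝔪`
  have hbcop : IsCoprime (Ideal.span {b}) 𝔪 := isCoprime_span_of_sub_mem hcop hbc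
  have hu1 : (u : 𝓞 K) - 1 ∈ 𝔪 := by
    refine mem_of_mul_mem_of_isCoprime hbcop ?_
    have : ((u : 𝓞 K) - 1) * b = (b' - c) - (b - c) := by rw [← hu]; ring
    rw [this]; exact 𝔪.sub_mem hb'c hbc
  have := hw u hu1
  rw [this, Units.val_one, mul_one] at hu
  exact hu

variable (𝔪 𝔠) in
/-- ★ **The narrow ray class of `𝔠` mod `𝔪` is parametrised by `𝔠⁻¹𝔪`** (de Shalit II.3.5, the substitution
behind (13); Neukirch VI (1.7)): for `K` with no real place, `𝔪 ≠ (1)` with `w_𝔪 = 1`, and `𝔠` prime to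
`𝔪`, there is a bijection `e : 𝔪/𝔠 ≃ {𝔞 : RayClassRel 𝔪 𝔠 𝔞}` such that every `e x` comes with nonzero
integers `b ≡ c mod 𝔪`, `c` prime to `𝔪`, `(c)·(e x) = (b)·𝔠`, `b = c(1 + x)` — i.e. `e x = (1 + x)𝔠`.
[cite: deShalit1987, II.3.5 (proof of (13))] [cite: NeukirchANT1999, Ch. VI §1 Def. (1.7)] -/
theorem exists_equiv_div_rayClassRel [IsTotallyComplex K] (h𝔪 : 𝔪 ≠ ⊤)
    (hw : ∀ u : (𝓞 K)ˣ, (u : 𝓞 K) - 1 ∈ 𝔪 → u = 1) (hcop : IsCoprime 𝔠 𝔪) :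
    ∃ e : ((𝔪 : FractionalIdeal (𝓞 K)⁰ K) / (𝔠 : FractionalIdeal (𝓞 K)⁰ K)) ≃
        {𝔞 : Ideal (𝓞 K) // RayClassRel 𝔪 𝔠 𝔞},
      ∀ x, ∃ b c : 𝓞 K, b ≠ 0 ∧ c ≠ 0 ∧ IsCoprime (Ideal.span {c}) 𝔪 ∧ b - c ∈ 𝔪 ∧
        Ideal.span {c} * (e x : Ideal (𝓞 K)) = Ideal.span {b} * 𝔠 ∧ (b : K) = c * (1 + (x : K)) := by
  classical
  have h𝔠 : 𝔠 ≠ ⊥ := by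
    rintro rfl
    exact h𝔪 (by simpa using Ideal.isCoprime_iff_sup_eq.mp hcop)
  -- the map `x ↦ (1 + x)𝔠` with its data, by choice from `exists_rayClassRel_of_mem_div`
  let g : ((𝔪 : FractionalIdeal (𝓞 K)⁰ K) / (𝔠 : FractionalIdeal (𝓞 K)⁰ K)) →
      {𝔞 : Ideal (𝓞 K) // RayClassRel 𝔪 𝔠 𝔞} := fun x ↦
    ⟨(exists_rayClassRel_of_mem_div h𝔪 hcop x.2).choose, by
      obtain ⟨b, c, h⟩ := (exists_rayClassRel_of_mem_div h𝔪 hcop x.2).choose_spec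
      exact h.2.2.2.2.2.2.2⟩
  have hg : ∀ x : ((𝔪 : FractionalIdeal (𝓞 K)⁰ K) / (𝔠 : FractionalIdeal (𝓞 K)⁰ K)),
      ∃ b c : 𝓞 K, b ≠ 0 ∧ c ≠ 0 ∧ c ∈ 𝔠 ∧ c - 1 ∈ 𝔪 ∧ b - c ∈ 𝔪 ∧
        Ideal.span {c} * (g x : Ideal (𝓞 K)) = Ideal.span {b} * 𝔠 ∧
        algebraMap (𝓞 K) K b = algebraMap (𝓞 K) K c * (1 + (x : K)) := by
    intro x
    obtain ⟨b, c, hb, hc, hc𝔠, hc1, hbc, heq, hbK, -⟩ :=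
      (exists_rayClassRel_of_mem_div h𝔪 hcop x.2).choose_spec
    exact ⟨b, c, hb, hc, hc𝔠, hc1, hbc, heq, hbK⟩
  have hbij : Function.Bijective g := by
    constructor
    · -- injective: same `𝔞` ⇒ `(c c')𝔞 = (b c')𝔠 = (b' c)𝔠` ⇒ `b c' = b' c` by `w_𝔪 = 1` ⇒ `x = x'`
      intro x x' hxx
      obtain ⟨b, c, hb, hc, -, hc1, hbc, heq, hbK⟩ := hg x
      obtain ⟨b', c', hb', hc', -, hc'1, hb'c', heq', hb'K⟩ := hg x'
      have hgx : (g x : Ideal (𝓞 K)) = g x' := congrArg Subtype.val hxx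
      have hcc : IsCoprime (Ideal.span {c * c'}) 𝔪 := by
        rw [← Ideal.span_singleton_mul_span_singleton]
        exact (isCoprime_span_singleton_of_sub_one_mem hc1).mul_left
          (isCoprime_span_singleton_of_sub_one_mem hc'1)
      have e1 : Ideal.span {c * c'} * (g x : Ideal (𝓞 K)) = Ideal.span {b * c'} * 𝔠 := by
        rw [← Ideal.span_singleton_mul_span_singleton, ← Ideal.span_singleton_mul_span_singleton,
          mul_right_comm, heq, mul_right_comm]
      have e2 : Ideal.span {c * c'} * (g x : Ideal (𝓞 K)) = Ideal.span {b' * c} * 𝔠 := by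
        rw [← Ideal.span_singleton_mul_span_singleton, ← Ideal.span_singleton_mul_span_singleton,
          hgx, mul_assoc, heq', ← mul_assoc, mul_comm (Ideal.span {c}) (Ideal.span {b'})]
      have hm1 : b * c' - c * c' ∈ 𝔪 := by
        rw [← sub_mul]; exact 𝔪.mul_mem_right _ hbc
      have hm2 : b' * c - c * c' ∈ 𝔪 := by
        rw [mul_comm c c', ← sub_mul]; exact 𝔪.mul_mem_right _ hb'c'
      have key := eq_of_span_mul_eq_of_units hw h𝔠 hcc hm1 hm2 e1 e2
      -- `b c' = b' c` in `K`: `c c' (1 + x) = c c' (1 + x')`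
      have hK : algebraMap (𝓞 K) K c * algebraMap (𝓞 K) K c' * (1 + (x : K)) =
          algebraMap (𝓞 K) K c * algebraMap (𝓞 K) K c' * (1 + (x' : K)) := by
        have := congrArg (algebraMap (𝓞 K) K) key
        rw [map_mul, map_mul, hbK, hb'K] at this
        linear_combination this
      have hcK : algebraMap (𝓞 K) K c ≠ 0 := fun h ↦
        hc (RingOfIntegers.coe_injective (by rw [h, map_zero]))
      have hc'K : algebraMap (𝓞 K) K c' ≠ 0 := fun h ↦
        hc' (RingOfIntegers.coe_injective (by rw [h, map_zero]))
      have : (x : K) = x' := by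
        have := mul_left_cancel₀ (mul_ne_zero hcK hc'K) hK
        linear_combination this
      exact Subtype.ext this
    · -- surjective: `𝔞 ~ 𝔠` via `(b, c)` is `g (b/c − 1)`
      rintro ⟨𝔞, h𝔞⟩
      obtain ⟨b, c, hb, hc, hccop, hbc, -, heq⟩ := h𝔞
      let x : ((𝔪 : FractionalIdeal (𝓞 K)⁰ K) / (𝔠 : FractionalIdeal (𝓞 K)⁰ K)) :=
        ⟨(b : K) / c - 1, div_sub_one_mem_div_of_span_mul_eq h𝔠 hc hccop hbc heq⟩
      refine ⟨x, Subtype.ext ?_⟩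
      obtain ⟨b₀, c₀, hb₀, hc₀, -, hc₀1, hb₀c₀, heq₀, hb₀K⟩ := hg x
      change (g x : Ideal (𝓞 K)) = 𝔞
      -- `(c)(c₀)(g x) = (c b₀)𝔠 = (c₀ b)𝔠 = (c₀)(c)𝔞`
      have hcK : algebraMap (𝓞 K) K c ≠ 0 := fun h ↦
        hc (RingOfIntegers.coe_injective (by rw [h, map_zero]))
      have hcb₀ : c * b₀ = c₀ * b := by
        apply RingOfIntegers.coe_injective
        rw [map_mul, map_mul, hb₀K]
        change algebraMap (𝓞 K) K c * (algebraMap (𝓞 K) K c₀ *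
            (1 + (algebraMap (𝓞 K) K b / algebraMap (𝓞 K) K c - 1))) =
          algebraMap (𝓞 K) K c₀ * algebraMap (𝓞 K) K b
        field_simp
        ring
      have e1 : Ideal.span {c} * Ideal.span {c₀} * (g x : Ideal (𝓞 K)) =
          Ideal.span {c} * Ideal.span {c₀} * 𝔞 := by
        rw [mul_assoc, heq₀, ← mul_assoc, Ideal.span_singleton_mul_span_singleton, hcb₀,
          ← Ideal.span_singleton_mul_span_singleton, mul_assoc, ← heq, ← mul_assoc,
          mul_comm (Ideal.span {c₀})]
      have hne : Ideal.span {c} * Ideal.span ({c₀} : Set (𝓞 K)) ≠ 0 :=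
        mul_ne_zero (by simpa [Ideal.zero_eq_bot, Ideal.span_singleton_eq_bot] using hc)
          (by simpa [Ideal.zero_eq_bot, Ideal.span_singleton_eq_bot] using hc₀)
      exact mul_left_cancel₀ hne e1
  refine ⟨Equiv.ofBijective g hbij, fun x ↦ ?_⟩
  obtain ⟨b, c, hb, hc, -, hc1, hbc, heq, hbK⟩ := hg x
  exact ⟨b, c, hb, hc, isCoprime_span_singleton_of_sub_one_mem hc1, hbc, heq, hbK⟩

end RayClass

/-! ### §2. The ideal character along the parametrisation: `ψ̃((1 + x)𝔠) = ψ̃(𝔠)·ιK(1 + x)` -/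

section Character

variable {𝔪 𝔠 : Ideal (𝓞 K)} {ψ : HeightOneSpectrum (𝓞 K) → ℂ}

/-- `ψ̃(𝔞) ≠ 0` for a nonzero ideal `𝔞` prime to `𝔪`, when `ψ ≠ 0` at the primes not dividing `𝔪`
(a character of `J^𝔪` takes nonzero values on `J^𝔪`). [cite: NeukirchANT1999, Ch. VII §6 Def. (6.8)] -/
theorem idealPow_ne_zero_of_isCoprime (hψ0 : ∀ v : HeightOneSpectrum (𝓞 K), ¬ 𝔪 ≤ v.asIdeal → ψ v ≠ 0)
    {𝔞 : Ideal (𝓞 K)} (h𝔞 : 𝔞 ≠ ⊥) (hcop : IsCoprime 𝔞 𝔪) : idealPow K ψ 𝔞 ≠ 0 := by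
  unfold idealPow
  rw [finprod_eq_prod _ (mulSupport_idealPow_finite ψ h𝔞)]
  refine Finset.prod_ne_zero_iff.mpr fun v _ ↦ ?_
  by_cases hcount : (Associates.mk v.asIdeal).count (Associates.mk 𝔞).factors = 0
  · rw [hcount, pow_zero]; exact one_ne_zero
  · refine pow_ne_zero _ (hψ0 v fun h𝔪v ↦ ?_)
    have hdvd : v.asIdeal ∣ 𝔞 :=
      (Associates.count_ne_zero_iff_dvd h𝔞 v.irreducible).mp hcount
    have h𝔞v : 𝔞 ≤ v.asIdeal := Ideal.dvd_iff_le.mp hdvd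
    have htop : 𝔞 ⊔ 𝔪 = ⊤ := Ideal.isCoprime_iff_sup_eq.mp hcop
    exact v.isPrime.ne_top (top_le_iff.mp (htop ▸ sup_le h𝔞v h𝔪v))

/-- **`φ(𝔞) = φ(𝔠)·α` for `𝔞 = (α)𝔠`, `α = b/c ≡ 1 mod* 𝔪`**: if `ψ̃` has "type `ιK`" on the ray
(`ψ̃((b))·ιK(c) = ψ̃((c))·ιK(b)` for nonzero `b ≡ c mod 𝔪`, `c` prime to `𝔪`) and `(c)𝔞 = (b)𝔠`, then
`ψ̃(𝔞)·ιK(c) = ψ̃(𝔠)·ιK(b)`. [cite: deShalit1987, II.3.5 (proof of (13))] -/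
theorem idealPow_eq_mul_of_span_mul_eq (ιK : K →+* ℂ)
    (hψ0 : ∀ v : HeightOneSpectrum (𝓞 K), ¬ 𝔪 ≤ v.asIdeal → ψ v ≠ 0)
    (hψ : ∀ b c : 𝓞 K, b ≠ 0 → c ≠ 0 → IsCoprime (Ideal.span {c}) 𝔪 → b - c ∈ 𝔪 →
      idealPow K ψ (Ideal.span {b}) * ιK c = idealPow K ψ (Ideal.span {c}) * ιK b)
    (h𝔠 : 𝔠 ≠ ⊥) {𝔞 : Ideal (𝓞 K)} {b c : 𝓞 K} (hb : b ≠ 0) (hc : c ≠ 0)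
    (hcop : IsCoprime (Ideal.span {c}) 𝔪) (hbc : b - c ∈ 𝔪)
    (heq : Ideal.span {c} * 𝔞 = Ideal.span {b} * 𝔠) :
    idealPow K ψ 𝔞 * ιK c = idealPow K ψ 𝔠 * ιK b := by
  have hb' : Ideal.span {b} ≠ ⊥ := by simpa using hb
  have hc' : Ideal.span {c} ≠ ⊥ := by simpa using hc
  have h𝔞 : 𝔞 ≠ ⊥ := by
    intro h
    rw [h, Ideal.mul_bot] at heq
    exact mul_ne_zero hb' h𝔠 heq.symm
  have key := congrArg (idealPow K ψ) heq
  rw [idealPow_mul ψ hc' h𝔞, idealPow_mul ψ hb' h𝔠] at key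
  have hne : idealPow K ψ (Ideal.span {c}) ≠ 0 := idealPow_ne_zero_of_isCoprime hψ0 hc' hcop
  have h2 := hψ b c hb hc hcop hbc
  -- `ψ̃(c)ψ̃(𝔞)ιK(c) = ψ̃(b)ψ̃(𝔠)ιK(c) = ψ̃(c)ιK(b)ψ̃(𝔠)`
  have : idealPow K ψ (Ideal.span {c}) * (idealPow K ψ 𝔞 * ιK c) =
      idealPow K ψ (Ideal.span {c}) * (idealPow K ψ 𝔠 * ιK b) := by
    calc idealPow K ψ (Ideal.span {c}) * (idealPow K ψ 𝔞 * ιK c)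
        = idealPow K ψ (Ideal.span {b}) * ιK c * idealPow K ψ 𝔠 := by rw [← mul_assoc, key]; ring
      _ = idealPow K ψ (Ideal.span {c}) * (idealPow K ψ 𝔠 * ιK b) := by rw [h2]; ring
  exact mul_left_cancel₀ hne this

/-- The "type `ιK` on the ray" hypothesis from the tree's `IsGrossencharakter 𝔪 p q ψ` whose archimedean
factor `∏_w σ_w(a)^{p_w} σ̄_w(a)^{q_w}` IS `ιK` (type `(1,0)` read through `ιK`: for an imaginary quadratic
`K`, `p = 1, q = 0` if `ιK` is the embedding of the infinite place, `p = 0, q = 1` if it is its conjugate).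
[cite: NeukirchANT1999, Ch. VII §6 Prop. (6.13) and Cor. (6.14)] -/
theorem idealPow_span_mul_eq_of_isGrossencharakter (ιK : K →+* ℂ) {p q : InfinitePlace K → ℤ}
    (hψ : IsGrossencharakter 𝔪 p q ψ)
    (hA : ∀ a : K, a ≠ 0 →
      ∏ w : InfinitePlace K, w.embedding a ^ (p w) * conj (w.embedding a) ^ (q w) = ιK a)
    (b c : 𝓞 K) (hb : b ≠ 0) (hc : c ≠ 0) (hcop : IsCoprime (Ideal.span {c}) 𝔪) (hbc : b - c ∈ 𝔪)
    (hpos : ∀ τ : K →+* ℝ, 0 < τ b * τ c) :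
    idealPow K ψ (Ideal.span {b}) * ιK c = idealPow K ψ (Ideal.span {c}) * ιK b := by
  have hcK : (c : K) ≠ 0 := fun h ↦ hc (by exact_mod_cast h)
  have hbK : (b : K) ≠ 0 := fun h ↦ hb (by exact_mod_cast h)
  have hιc : ιK c ≠ 0 := (map_ne_zero ιK).mpr hcK
  have h := hψ.idealPow_span_eq b c hb hc hcop hbc hpos
  rw [hA _ (div_ne_zero hbK hcK), map_div₀] at h
  rw [h, mul_assoc, div_mul_cancel₀ _ hιc]

end Character

end Literature.NumberTheory.LFunctions

end
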